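import Mathlib
import Summits.Ventures.HodgeRepro.Tier4.Common.AdelicDefs
import Summits.Ventures.HodgeRepro.Tier4.Common.AdelicPlaces
import Summits.Ventures.HodgeRepro.Tier4.Common.CompactOpenLevel
import Summits.Ventures.HodgeRepro.Tier4.Common.MixedPlaneKType
import Summits.Ventures.HodgeRepro.Tier4.Common.LocalTorusCompact
import Summits.Ventures.HodgeRepro.Tier4.Common.PlaceCommute
import Summits.Ventures.HodgeRepro.Tier4.Line1.AdelicParts
import Summits.Ventures.HodgeRepro.Tier4.Line1.FiniteLevelIsolation

/-!
# Tier4/Common/ArchAssemble — `G_∞ = ∏_w G_w`: assembling an element of the archimedean part from its components at the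
infinite places, and the `w`-slice `ofPlace w g`

Blind re-derivation cell `pub-hodge-repro`, Tier 4 «prove the step» (README §9–§10), seat t4-typer-2 (gen 4), module 1 of
the offer S14892 (C-COMMON-ARCHSPLIT, the FACTOR of L1-p5 g4's S14811 (2): «`T_∞ = ∏_w T_w` and a product Haar — NOT in
the tree»).  Target tree path `lean/Summits/Ventures/HodgeRepro/Tier4/Common/ArchAssemble.lean`.  Imports: Mathlib +
Common (`AdelicDefs`, `AdelicPlaces`: `adComponentInf`, `GA.infiniteComponent`; `CompactOpenLevel`: `infPart`;
`MixedPlaneKType`: `atPlace`, `localTorusAt`; `LocalTorusCompact`: `infiniteComponent_eq_one_iff`,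
`finiteComponent_eq_one_iff`; `PlaceCommute`: `GA.ext_of_components`) + Line1 (`AdelicParts`: `infM`, `finM`, `mixM`,
`M4_ext`; `FiniteLevelIsolation`: `infinitePart`).

THE CONSTRUCTION.  The infinite adele ring is the product `∀ w, k_w`; an archimedean `4 × 4` matrix is a family of
`4 × 4` matrices over the `k_w` (`sliceAt w`), and matrix multiplication is slice-wise.  Given a family
`κ : InfinitePlace k → GA W`, `assemble κ` is the element of `G(𝔸)` whose `w`-component is the `w`-component of `κ w` and
whose finite part is `1` (`assembleInf`, `assembleMat = mixM (assembleInf κ) 1`); it is a unit (inverse `assemble κ⁻¹`)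
and unitary because every relation `g Ω = Ω g`, `g B gᵀ = B` holds slice by slice.  `ofPlace w g := assemble (w ↦ g, 1
elsewhere)` is the `w`-slice of `g`; `assemble (w ↦ ofPlace w g) = g` for `g ∈ G_∞` (`GA.ext_of_components`) and
`ofPlace w (assemble κ) = κ w` when each `κ w` is supported at `w` — so `G_∞ ≅ ∏_w G_w` with no ordering of the places,
and the same for the tori (`assemble_mem_torusT`, `ofPlace_mem_localTorusAt`).  Everything is continuous.

* `sliceAt`, `sliceAt_mul`, `sliceAt_one`, `sliceAt_transpose`, `sliceAt_infM`, `ext_of_sliceAt`;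
* `assembleInf`, `assembleMat`, `assembleMat_mul`, `assembleMat_one`, **`assemble`**, `mat_assemble`, `assemble_mul`,
  `assemble_one`, **`infiniteComponent_assemble`**, `finiteComponent_assemble`, `assemble_mem_infinitePart`,
  `assemble_mem_commutant`, `assemble_mem_torusT`, `assemble_mem_torusT'`, `continuous_assemble`;
* **`ofPlace`**, `infiniteComponent_ofPlace_self`, `infiniteComponent_ofPlace_of_ne`, `ofPlace_mem_atPlace`, `ofPlace_mul`,
  `ofPlace_one`, `ofPlace_mem_torusT`, `ofPlace_mem_torusT'`, `ofPlace_mem_localTorusAt`, `ofPlace_mem_localTorusAt'`,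
  `continuous_ofPlace`, **`assemble_ofPlace`** (`g ∈ G_∞ ⇒ assemble (ofPlace · g) = g`), **`ofPlace_assemble`**.
The homeomorphism `torusInf W ≃ₜ* ∀ w, localTorusAt W w` and the product Haar are the companion `Common/ArchSplit.lean`.

Nothing here says anything about the status of the Hodge conjecture for CM abelian varieties, which is NOT proved
(HC_CM is NOT proved by anyone in this repository).
-/

set_option autoImplicit false

noncomputable section

namespace Summit.Ventures.HodgeRepro.Tier4.Common

open NumberField IsDedekindDomain Matrix Set Topology Summit.Ventures.HodgeRepro.Tier4.Line1
open scoped Classical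

section Slices

variable {k : Type} [Field k] [NumberField k]

/-- The `w`-slice of an archimedean matrix (the infinite adele ring is `∀ w, k_w`). -/
def sliceAt (w : InfinitePlace k) (A : Matrix (Fin 4) (Fin 4) (InfiniteAdeleRing k)) :
    Matrix (Fin 4) (Fin 4) w.Completion :=
  fun i j => A i j w

omit [NumberField k] in
/-- Slices are multiplicative. -/
theorem sliceAt_mul (w : InfinitePlace k) (A B : Matrix (Fin 4) (Fin 4) (InfiniteAdeleRing k)) :
    sliceAt w (A * B) = sliceAt w A * sliceAt w B := by
  refine Matrix.ext fun i j => ?_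
  show (∑ l, A i l * B l j) w = ∑ l, A i l w * B l j w
  exact Finset.sum_apply (M := fun w : InfinitePlace k => w.Completion) w Finset.univ (fun l => A i l * B l j)

omit [NumberField k] in
/-- The slice of the identity. -/
theorem sliceAt_one (w : InfinitePlace k) :
    sliceAt w (1 : Matrix (Fin 4) (Fin 4) (InfiniteAdeleRing k)) = 1 := by
  ext i j
  simp only [sliceAt, Matrix.one_apply]
  split_ifs <;> rfl

omit [NumberField k] in
/-- The slice of a transpose. -/
theorem sliceAt_transpose (w : InfinitePlace k) (A : Matrix (Fin 4) (Fin 4) (InfiniteAdeleRing k)) :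
    sliceAt w Aᵀ = (sliceAt w A)ᵀ := rfl

/-- The slice of the archimedean part of an adelic matrix is its `w`-component. -/
theorem sliceAt_infM (w : InfinitePlace k) (M : M4 k) : sliceAt w (infM k M) = M.map (adComponentInf k w) := rfl

omit [NumberField k] in
/-- An archimedean matrix is determined by its slices. -/
theorem ext_of_sliceAt {A B : Matrix (Fin 4) (Fin 4) (InfiniteAdeleRing k)}
    (h : ∀ w : InfinitePlace k, sliceAt w A = sliceAt w B) : A = B := by
  ext i j
  funext w
  exact congrFun (congrFun (h w) i) j

/-- `adComponentInf` is continuous. -/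
theorem continuous_adComponentInf (w : InfinitePlace k) : Continuous (adComponentInf k w) :=
  (continuous_apply w).comp continuous_fst

end Slices

section Assemble

variable {k : Type} [Field k] [NumberField k] (W : PlaneData k)

/-- The `w`-component of `g`, entrywise (the matrix of `GA.infiniteComponent W w g`). -/
theorem infiniteComponent_apply (w : InfinitePlace k) (g : GA W) (i j : Fin 4) :
    ((GA.infiniteComponent W w g : GL (Fin 4) w.Completion) : Matrix (Fin 4) (Fin 4) w.Completion) i j =
      adComponentInf k w (GA.mat W g i j) := rfl

/-- The archimedean matrix whose `w`-slice is the `w`-component of `κ w`. -/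
def assembleInf (κ : InfinitePlace k → GA W) : Matrix (Fin 4) (Fin 4) (InfiniteAdeleRing k) :=
  fun i j w => adComponentInf k w (GA.mat W (κ w) i j)

/-- The slice of the assembled matrix. -/
theorem sliceAt_assembleInf (κ : InfinitePlace k → GA W) (w : InfinitePlace k) :
    sliceAt w (assembleInf W κ) = (GA.mat W (κ w)).map (adComponentInf k w) := rfl

/-- The adelic matrix with archimedean part `assembleInf κ` and finite part `1`. -/
def assembleMat (κ : InfinitePlace k → GA W) : M4 k := mixM k (assembleInf W κ) 1

/-- The archimedean part of the assembled matrix. -/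
theorem infM_assembleMat (κ : InfinitePlace k → GA W) : infM k (assembleMat W κ) = assembleInf W κ :=
  infM_mixM _ _

/-- The finite part of the assembled matrix is `1`. -/
theorem finM_assembleMat (κ : InfinitePlace k → GA W) : finM k (assembleMat W κ) = 1 :=
  finM_mixM _ _

/-- Assembling is multiplicative. -/
theorem assembleMat_mul (κ κ' : InfinitePlace k → GA W) :
    assembleMat W κ * assembleMat W κ' = assembleMat W (fun w => κ w * κ' w) := by
  apply M4_ext
  · rw [infM_mul, infM_assembleMat, infM_assembleMat, infM_assembleMat]
    apply ext_of_sliceAt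
    intro w
    rw [sliceAt_mul, sliceAt_assembleInf, sliceAt_assembleInf, sliceAt_assembleInf, GA.mat_mul, Matrix.map_mul]
  · rw [finM_mul, finM_assembleMat, finM_assembleMat, finM_assembleMat, Matrix.one_mul]

/-- Assembling the constant family `1` gives `1`. -/
theorem assembleMat_one : assembleMat W (fun _ => (1 : GA W)) = 1 := by
  apply M4_ext
  · rw [infM_assembleMat, infM_one]
    apply ext_of_sliceAt
    intro w
    rw [sliceAt_assembleInf, sliceAt_one]
    have h1 : GA.mat W (1 : GA W) = 1 := rfl
    rw [h1]
    exact Matrix.map_one _ (map_zero _) (map_one _)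
  · rw [finM_assembleMat, finM_one]

/-- The assembled matrix commutes with `adMat A` when every `κ w` does. -/
theorem assembleMat_comm {A : Matrix (Fin 4) (Fin 4) k} {κ : InfinitePlace k → GA W}
    (hκ : ∀ w, GA.mat W (κ w) * adMat k A = adMat k A * GA.mat W (κ w)) :
    assembleMat W κ * adMat k A = adMat k A * assembleMat W κ := by
  apply M4_ext
  · rw [infM_mul, infM_mul, infM_assembleMat]
    apply ext_of_sliceAt
    intro w
    rw [sliceAt_mul, sliceAt_mul, sliceAt_assembleInf, sliceAt_infM, ← Matrix.map_mul, ← Matrix.map_mul, hκ w]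
  · rw [finM_mul, finM_mul, finM_assembleMat, Matrix.one_mul, Matrix.mul_one]

/-- The assembled matrix preserves `adMat B` when every `κ w` does. -/
theorem assembleMat_form {B : Matrix (Fin 4) (Fin 4) k} {κ : InfinitePlace k → GA W}
    (hκ : ∀ w, GA.mat W (κ w) * adMat k B * (GA.mat W (κ w))ᵀ = adMat k B) :
    assembleMat W κ * adMat k B * (assembleMat W κ)ᵀ = adMat k B := by
  apply M4_ext
  · rw [infM_mul, infM_mul, infM_transpose, infM_assembleMat]
    apply ext_of_sliceAt
    intro w
    rw [sliceAt_mul, sliceAt_mul, sliceAt_transpose, sliceAt_assembleInf, sliceAt_infM, ← Matrix.transpose_map,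
      ← Matrix.map_mul, ← Matrix.map_mul, hκ w]
  · rw [finM_mul, finM_mul, finM_transpose, finM_assembleMat, Matrix.one_mul, Matrix.transpose_one, Matrix.mul_one]

/-- **The element of `G(𝔸)` assembled from a family of components**: `w`-component that of `κ w`, finite part `1`. -/
def assemble (κ : InfinitePlace k → GA W) : GA W :=
  ⟨⟨assembleMat W κ, assembleMat W (fun w => (κ w)⁻¹),
    by rw [assembleMat_mul]; simp only [mul_inv_cancel]; exact assembleMat_one W,
    by rw [assembleMat_mul]; simp only [inv_mul_cancel]; exact assembleMat_one W⟩,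
    ⟨assembleMat_comm W fun w => ((mem_unitaryGroup W _).1 (κ w).2).1,
      assembleMat_form W fun w => ((mem_unitaryGroup W _).1 (κ w).2).2⟩⟩

/-- The matrix of the assembled element. -/
theorem mat_assemble (κ : InfinitePlace k → GA W) : GA.mat W (assemble W κ) = assembleMat W κ := rfl

/-- Assembling is multiplicative. -/
theorem assemble_mul (κ κ' : InfinitePlace k → GA W) :
    assemble W (fun w => κ w * κ' w) = assemble W κ * assemble W κ' :=
  Subtype.ext (Units.ext (assembleMat_mul W κ κ').symm)

/-- Assembling the constant family `1`. -/
theorem assemble_one : assemble W (fun _ => (1 : GA W)) = 1 :=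
  Subtype.ext (Units.ext (assembleMat_one W))

/-- **The `w`-component of the assembled element is the `w`-component of `κ w`.** -/
theorem infiniteComponent_assemble (κ : InfinitePlace k → GA W) (w : InfinitePlace k) :
    GA.infiniteComponent W w (assemble W κ) = GA.infiniteComponent W w (κ w) := by
  apply Units.ext
  refine Matrix.ext fun i j => ?_
  rfl

/-- The finite components of the assembled element are `1`. -/
theorem finiteComponent_assemble (κ : InfinitePlace k → GA W) (v : HeightOneSpectrum (𝓞 k)) :
    GA.finiteComponent W v (assemble W κ) = 1 := by
  rw [finiteComponent_eq_one_iff]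
  intro i j
  show (RestrictedProduct.evalRingHom (fun v : HeightOneSpectrum (𝓞 k) => v.adicCompletion k) v)
    ((1 : Matrix (Fin 4) (Fin 4) (FiniteAdeleRing (𝓞 k) k)) i j) = _
  by_cases h : i = j
  · subst h
    rw [Matrix.one_apply_eq, Matrix.one_apply_eq]
    exact RingHom.map_one _
  · rw [Matrix.one_apply_ne h, Matrix.one_apply_ne h]
    exact RingHom.map_zero _

/-- The assembled element lies in `G_∞`. -/
theorem assemble_mem_infinitePart (κ : InfinitePlace k → GA W) : assemble W κ ∈ infinitePart W := by
  rw [mem_infinitePart, mat_assemble, finM_assembleMat]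

/-- The assembled element lies in a commutant when every `κ w` does. -/
theorem assemble_mem_commutant (A : Matrix (Fin 4) (Fin 4) k) {κ : InfinitePlace k → GA W}
    (hκ : ∀ w, κ w ∈ commutant W A) : assemble W κ ∈ commutant W A :=
  assembleMat_comm W fun w => hκ w

/-- The assembled element lies in `T` when every `κ w` does. -/
theorem assemble_mem_torusT {κ : InfinitePlace k → GA W} (hκ : ∀ w, κ w ∈ torusT W) : assemble W κ ∈ torusT W :=
  ⟨assemble_mem_commutant W _ fun w => (hκ w).1, assemble_mem_commutant W _ fun w => (hκ w).2⟩

/-- The assembled element lies in `T′` when every `κ w` does. -/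
theorem assemble_mem_torusT' {κ : InfinitePlace k → GA W} (hκ : ∀ w, κ w ∈ torusT' W) : assemble W κ ∈ torusT' W :=
  ⟨assemble_mem_commutant W _ fun w => (hκ w).1, assemble_mem_commutant W _ fun w => (hκ w).2⟩

/-- `assembleMat` is continuous in the family. -/
theorem continuous_assembleMat : Continuous fun κ : InfinitePlace k → GA W => assembleMat W κ := by
  refine continuous_matrix fun i j => ?_
  show Continuous fun κ : InfinitePlace k → GA W =>
    ((fun w => adComponentInf k w (GA.mat W (κ w) i j) : InfiniteAdeleRing k),
      (1 : Matrix (Fin 4) (Fin 4) (FiniteAdeleRing (𝓞 k) k)) i j)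
  refine Continuous.prodMk ?_ continuous_const
  refine continuous_pi fun w => ?_
  exact (continuous_adComponentInf w).comp
    (((Units.continuous_val.comp continuous_subtype_val).matrix_elem i j).comp (continuous_apply w))

/-- **`assemble` is continuous** (the matrix and the inverse matrix depend continuously on the family). -/
theorem continuous_assemble : Continuous (assemble W) := by
  refine Continuous.subtype_mk ?_ _
  refine Units.continuous_iff.2 ⟨?_, ?_⟩
  · exact continuous_assembleMat W
  · exact (continuous_assembleMat W).comp (continuous_pi fun w => continuous_inv.comp (continuous_apply w))

end Assemble

section OfPlace

variable {k : Type} [Field k] [NumberField k] (W : PlaneData k)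

/-- **The `w`-slice of `g`**: the element with the `w`-component of `g` and all other components `1`. -/
def ofPlace (w : InfinitePlace k) (g : GA W) : GA W := assemble W fun w' => if w' = w then g else 1

/-- The `w`-component of the `w`-slice is that of `g`. -/
theorem infiniteComponent_ofPlace_self (w : InfinitePlace k) (g : GA W) :
    GA.infiniteComponent W w (ofPlace W w g) = GA.infiniteComponent W w g := by
  rw [ofPlace, infiniteComponent_assemble, if_pos rfl]

/-- The other components of the `w`-slice are `1`. -/
theorem infiniteComponent_ofPlace_of_ne {w w' : InfinitePlace k} (h : w' ≠ w) (g : GA W) :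
    GA.infiniteComponent W w' (ofPlace W w g) = 1 := by
  rw [ofPlace, infiniteComponent_assemble, if_neg h, map_one]

/-- The `w`-slice is supported at `w`. -/
theorem ofPlace_mem_atPlace (w : InfinitePlace k) (g : GA W) : ofPlace W w g ∈ atPlace W w :=
  ⟨fun v => finiteComponent_assemble W _ v, fun _ h => infiniteComponent_ofPlace_of_ne W h g⟩

/-- The `w`-slice is multiplicative. -/
theorem ofPlace_mul (w : InfinitePlace k) (g h : GA W) : ofPlace W w (g * h) = ofPlace W w g * ofPlace W w h := by
  rw [ofPlace, ofPlace, ofPlace, ← assemble_mul]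
  congr 1
  funext w'
  by_cases h : w' = w
  · rw [if_pos h, if_pos h, if_pos h]
  · rw [if_neg h, if_neg h, if_neg h, one_mul]

/-- The `w`-slice of `1`. -/
theorem ofPlace_one (w : InfinitePlace k) : ofPlace W w (1 : GA W) = 1 := by
  rw [ofPlace]
  simp only [ite_self]
  exact assemble_one W

/-- The `w`-slice of an element of `T` lies in `T`. -/
theorem ofPlace_mem_torusT (w : InfinitePlace k) {g : GA W} (hg : g ∈ torusT W) : ofPlace W w g ∈ torusT W :=
  assemble_mem_torusT W fun w' => by
    by_cases h : w' = w
    · rw [if_pos h]; exact hg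
    · rw [if_neg h]; exact (torusT W).one_mem

/-- The `w`-slice of an element of `T′` lies in `T′`. -/
theorem ofPlace_mem_torusT' (w : InfinitePlace k) {g : GA W} (hg : g ∈ torusT' W) : ofPlace W w g ∈ torusT' W :=
  assemble_mem_torusT' W fun w' => by
    by_cases h : w' = w
    · rw [if_pos h]; exact hg
    · rw [if_neg h]; exact (torusT' W).one_mem

/-- The `w`-slice of an element of `T` lies in the local torus at `w`. -/
theorem ofPlace_mem_localTorusAt (w : InfinitePlace k) {g : GA W} (hg : g ∈ torusT W) :
    ofPlace W w g ∈ localTorusAt W w :=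
  ⟨ofPlace_mem_torusT W w hg, ofPlace_mem_atPlace W w g⟩

/-- The `w`-slice of an element of `T′` lies in the local torus `T′_w`. -/
theorem ofPlace_mem_localTorusAt' (w : InfinitePlace k) {g : GA W} (hg : g ∈ torusT' W) :
    ofPlace W w g ∈ localTorusAt' W w :=
  ⟨ofPlace_mem_torusT' W w hg, ofPlace_mem_atPlace W w g⟩

/-- `ofPlace w` is continuous. -/
theorem continuous_ofPlace (w : InfinitePlace k) : Continuous (ofPlace W w) := by
  refine (continuous_assemble W).comp (continuous_pi fun w' => ?_)
  by_cases h : w' = w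
  · simp only [if_pos h]; exact continuous_id
  · simp only [if_neg h]; exact continuous_const

/-- The finite components of an element of `G_∞` are `1`. -/
theorem finiteComponent_eq_one_of_mem_infinitePart {g : GA W} (hg : g ∈ infinitePart W)
    (v : HeightOneSpectrum (𝓞 k)) : GA.finiteComponent W v g = 1 := by
  rw [finiteComponent_eq_one_iff]
  intro i j
  have h := congrFun (congrFun ((mem_infinitePart W g).1 hg) i) j
  simp only [finM, Matrix.map_apply] at h
  show (RestrictedProduct.evalRingHom (fun v : HeightOneSpectrum (𝓞 k) => v.adicCompletion k) v)
    (finPart k (GA.mat W g i j)) = _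
  rw [h]
  by_cases hij : i = j
  · subst hij
    rw [Matrix.one_apply_eq, Matrix.one_apply_eq]
    exact RingHom.map_one _
  · rw [Matrix.one_apply_ne hij, Matrix.one_apply_ne hij]
    exact RingHom.map_zero _

/-- **`G_∞ = ∏_w G_w`**: an element of `G_∞` is the assembly of its slices. -/
theorem assemble_ofPlace {g : GA W} (hg : g ∈ infinitePart W) : assemble W (fun w => ofPlace W w g) = g := by
  apply GA.ext_of_components
  · intro w
    rw [infiniteComponent_assemble, infiniteComponent_ofPlace_self]
  · intro v
    rw [finiteComponent_assemble, finiteComponent_eq_one_of_mem_infinitePart W hg v]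

/-- The slices of an assembly of elements supported at their places are the elements. -/
theorem ofPlace_assemble {κ : InfinitePlace k → GA W} (hκ : ∀ w, κ w ∈ atPlace W w) (w : InfinitePlace k) :
    ofPlace W w (assemble W κ) = κ w := by
  apply GA.ext_of_components
  · intro w'
    by_cases h : w' = w
    · subst h
      rw [infiniteComponent_ofPlace_self, infiniteComponent_assemble]
    · rw [infiniteComponent_ofPlace_of_ne W h, (hκ w).2 w' h]
  · intro v
    rw [ofPlace, finiteComponent_assemble, (hκ w).1 v]

end OfPlace

end Summit.Ventures.HodgeRepro.Tier4.Common

end
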